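import Summits.CriticalPhenomena.PercolationContinuityZ3.Theses.PercNonProliferation
import Summits.CriticalPhenomena.PercolationContinuityZ3.Theses.PercAnnulusCrossing
import Literature.Barriers.CriticalPhenomena.SpanningClustersAboveSixProofs
import Literature.Probability.Percolation.SupercriticalClusterTransienceSeeds
import Literature.Probability.Percolation.GMFiniteSize
import Literature.Probability.Percolation.UniformPercolation
import Literature.Probability.Percolation.CorrelationLengthDKTProofs
import Literature.Probability.Percolation.SharpnessDCTProofs
import Literature.Probability.Percolation.FiniteEnergy
import Literature.Probability.Percolation.HalfSpaceBrickUp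

/-!
# Disproof of `SubpolynomialBlocking` — findings

Crux `PercNonProliferation.SubpolynomialBlocking` (item stmt-CriticalPhenomena-4446):
`∀ s > 0, ∀ᶠ n, n^{-s} ≤ u_n`, where `u_n := P_{p_c(ℤ³)}(Λ_n ↮ ∂ⁱⁿΛ_{2n} inside Λ_{2n})` is the
critical annulus-BLOCKING probability (`u_n = 1 - P(annulusCrossing 3 n)`, `blockProb` below).

VERDICT (standing disprover, cycle 1): NO KILL. The statement is a genuine open problem (an
RSW-type LOWER bound at `p_c(ℤ³)`, weaker than `PercAnnulusCrossing.CritAnnulusNonCrossing`);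
every cheap attack below either lands on a provable NEIGHBOUR of the crux or is blocked by the
absence of any 3-D crossing estimate. What this file PROVES (all `sorry`-free unless marked):

* §1 bookkeeping: the crux is `SubpolynomialBlockingAt 3 p_c` (`crux_iff`, `Iff.rfl`); the event is
  the complement of `Literature.Barriers.CriticalPhenomena.annulusCrossing 3 n`; measurability;
  `blockProb = 1 - P(cross)`.
* §2 LOAD-BEARING `p = p_c` FROM ABOVE (any proof must use `p ≤ p_c`): for every `d ≥ 3` and every
  `p > p_c(ℤ^d)`, `blockProb d p n ≤ e^{-γ n}` (GKZ 1993 Lemma 5 via Grimmett–Marstrand, in tree) and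
  hence `¬ SubpolynomialBlockingAt d p` (`not_subpolynomialBlockingAt_of_criticalProb_lt`); so the
  crux has NO open neighbourhood in `p` (`not_exists_nhds_criticalProb`).
* §3 `p = p_c` FROM BELOW is NOT load-bearing: for `p < p_c(ℤ^d)`, `d ≥ 2`, the statement is TRUE
  (`subpolynomialBlockingAt_of_lt_criticalProb`: `P_p(cross) ≤ |Λ_n| e^{-cn} → 0` by sharpness, in tree).
  So the crux sits exactly at the phase boundary: true on `[0,p_c)`, false on `(p_c,1]`, open at `p_c`.
* §4 LOAD-BEARING `d = 3 < 7` (any proof must use a low-dimensional input): in every `d ≥ 7` with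
  Aizenman's (t-c)/`η = 0` hypothesis `TwoPointBoundedRatio d` the `d`-dimensional crux is FALSE with an
  explicit rate, `blockProb d p_c n ≤ K/n` (`blockProb_le_div`; sharper `≤ K/n^{d-6}`, `blockProb_le_div_pow`; second-moment bound
  `real_numSpanning_ge` of the barrier `SpanningClustersAboveSix`), hence
  `not_subpolynomialBlockingAt_criticalProb_above_six`; unconditional modulo the named fact
  `Hara2008_etaZeroXSpace` for `d ≥ 11` (`not_subpolynomialBlockingAt_criticalProb_of_hara`).
  The barrier file only had `P(cross) → 1` WITHOUT rate; the rate `1/n` is what kills the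
  sub-polynomial form.
* §5 JUMP WORLD: `θ(p) > 0 ⇒ blockProb d p n → 0` (`tendsto_blockProb_zero_of_theta_pos`, uniform
  percolation from large sets, in tree). So if `θ(p_c) > 0` the crux is a pure RATE statement
  (`u_n → 0` slower than any power) — consistent, not refutable this way; and calibration
  `CritAnnulusNonCrossing → SubpolynomialBlocking` (`of_critAnnulusNonCrossing`).
* §6 REFUTED NATURAL STRENGTHENINGS at `p_c(ℤ³)` (all from `blockProb_lt_one`: a straight critical
  arm has positive probability): uniform-in-`s` eventuality (`not_uniform_in_s`), the `s = 0`
  endpoint (`not_exponent_zero`), and "for all `n ≥ 1`" instead of eventually (`not_forall_n`).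
* §7 WHAT IS KNOWN UNCONDITIONALLY: only the trivial surface-order floor
  `(1 - p_c)^{|∂_E Λ_n|} ≤ u_n` (`pow_card_edgeBoundary_le_blockProb`), i.e. `u_n ≥ e^{-C n²}`, against
  the claimed `n^{-s}`; TIGHT at `n = 1`: `u_1 = (1-p)^{|∂_E Λ_1|}` exactly (`blockProb_one_eq`; `(1-p_c)^{54} ≈ 1.9·10⁻⁷` on `ℤ³`); from above `u_n ≤ 1 - P_{p_c}(0 ↔ ∂Λ_{2n}) < 1` (here), `u_n ≤ 1 - c` in print
  (critical crossing probability `≥ c`, finite-size criterion).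
* §7b ASPECT RATIO: `u^{(2)}_{2n} ≤ u^{(4)}_n` (`blockProbR_two_le_four`): the crux (ratio 2) is the strongest of the
  ratio-`2^k` family; repair candidate (ratio `R ≥ 4`) recorded in case ratio-2 numerics decay.
* §8 `-- Targets`: none yet (payload.stuck_stubs empty).

WHY IT RESISTS. A disproof needs `P_{p_c}(cross) ≥ 1 - n^{-s}` on a subsequence in `d = 3`, i.e. the
`d > 6` proliferation picture (§4) in three dimensions — contradicted by all numerics (wrapping
probability `R_c ≈ 0.258 ∈ (0,1)`, arXiv:1302.0421) and by hyperscaling; no known mechanism produces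
crossing probability `→ 1` at `p_c` below `d_c = 6` (the second-moment method needs `τ ≍ |x|^{2-d}`,
false for `d < 6` by `TwoPointBoundedRatio.six_le`). A proof needs ANY polynomial-in-`n` lower bound on
a critical blocking probability in `ℤ³`; none exists in print (RSW open in `d = 3`; slabs only,
Newman–Tassion–Wu 2017; state of the art read this cycle: Hutchcroft, arXiv:2508.18808 (2025), p. 5
"progress in intermediate dimensions `2 < d < 6` … has been extremely limited", and p. 52: hyperscaling
statements for nearest-neighbour `d = 3, 4, 5` are available only "under appropriate hyperscaling
postulates (as was done … following [BCKS 1999])" — the crux IS such a postulate, in its weakest form). The honest gap: known `e^{-Cn²} ≤ u_n ≤ 1 - c` (§7) vs claimed `u_n ≥ n^{-s}`.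
LOAD-BEARING SUMMARY for provers: a proof must use (i) `p ≤ p_c` (§2: false for every `p > p_c`) and
(ii) an input failing in `d ≥ 7` under `η = 0` (§4) — e.g. hyperscaling / `d < 6` arm exponents; it may
NOT rely on `θ(p_c) = 0` being false or true (§5: consistent with both).
-/

noncomputable section

namespace Summit.CriticalPhenomena.PercolationContinuityZ3.Cruxes.SubpolynomialBlocking.Disproof

open MeasureTheory Filter Topology
open Literature.Probability.Percolation Literature.Probability.LatticeModels
open Literature.Barriers.CriticalPhenomena
open Literature.Probability.Percolation.DCT16
open Summit.CriticalPhenomena.PercolationContinuityZ3.Theses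

/-! ## §1 Bookkeeping: the parametrised crux, the blocking probability, measurability -/

/-- The crux with the dimension `d` and the parameter `p` freed:
`∀ s > 0, ∀ᶠ n, n^{-s} ≤ P_p(Λ_n ↮ ∂ⁱⁿΛ_{2n} in Λ_{2n})` on `ℤ^d`. The crux is the instance
`d = 3`, `p = p_c(ℤ³)` (`crux_iff`). -/
def SubpolynomialBlockingAt (d : ℕ) (p : unitInterval) : Prop :=
  ∀ s : ℝ, 0 < s → ∀ᶠ n : ℕ in atTop, (n : ℝ) ^ (-s) ≤
    (bondPercolation (zdGraph d) p).real {ω | ¬ ∃ x ∈ box d n,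
      ∃ y ∈ innerBoundary (zdGraph d) (box d (2 * n)),
        ω ∈ openConnIn (↑(box d (2 * n)) : Set (Site d)) x y}

/-- The blocking probability `u_n(d, p) = P_p((annulusCrossing d n)ᶜ)`. -/
def blockProb (d : ℕ) (p : unitInterval) (n : ℕ) : ℝ :=
  (bondPercolation (zdGraph d) p).real (annulusCrossing d n)ᶜ

/-- The crux IS `SubpolynomialBlockingAt 3 p_c` (definitional). -/
theorem crux_iff :
    PercNonProliferation.SubpolynomialBlocking ↔ SubpolynomialBlockingAt 3 (criticalProbI 3) :=
  Iff.rfl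

/-- The crux's event is the complement of the barrier file's `annulusCrossing` (definitional). -/
theorem blockingEvent_eq (d n : ℕ) :
    {ω : BondConfig (Site d) | ¬ ∃ x ∈ box d n, ∃ y ∈ innerBoundary (zdGraph d) (box d (2 * n)),
      ω ∈ openConnIn (↑(box d (2 * n)) : Set (Site d)) x y} = (annulusCrossing d n)ᶜ :=
  rfl

/-- `SubpolynomialBlockingAt` through `blockProb` (definitional). -/
theorem subpolynomialBlockingAt_iff (d : ℕ) (p : unitInterval) :
    SubpolynomialBlockingAt d p ↔
      ∀ s : ℝ, 0 < s → ∀ᶠ n : ℕ in atTop, (n : ℝ) ^ (-s) ≤ blockProb d p n :=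
  Iff.rfl

/-- What a DISPROOF must produce (push the negation through): some `s > 0` such that, for infinitely
many `n`, the critical annulus is crossed with probability `> 1 - n^{-s}` (`u_n < n^{-s}` frequently). -/
theorem not_subpolynomialBlockingAt_iff (d : ℕ) (p : unitInterval) :
    ¬ SubpolynomialBlockingAt d p ↔
      ∃ s : ℝ, 0 < s ∧ ∃ᶠ n : ℕ in atTop, blockProb d p n < (n : ℝ) ^ (-s) := by
  rw [subpolynomialBlockingAt_iff]
  push Not
  rfl

/-- `annulusCrossing` as a finite union of box-connection events. -/
theorem annulusCrossing_eq_iUnion (d n : ℕ) :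
    annulusCrossing d n = ⋃ x ∈ box d n, ⋃ y ∈ innerBoundary (zdGraph d) (box d (2 * n)),
      openConnIn (↑(box d (2 * n)) : Set (Site d)) x y := by
  ext ω
  simp only [annulusCrossing, Set.mem_setOf_eq, Set.mem_iUnion, exists_prop]

/-- The annulus-crossing event is measurable. -/
theorem measurableSet_annulusCrossing (d n : ℕ) : MeasurableSet (annulusCrossing d n) := by
  rw [annulusCrossing_eq_iUnion]
  exact Finset.measurableSet_biUnion _ fun x _ =>
    Finset.measurableSet_biUnion _ fun y _ => measurableSet_openConnIn _ x y

/-- `u_n = 1 - P(cross)`. -/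
theorem blockProb_eq (d : ℕ) (p : unitInterval) (n : ℕ) :
    blockProb d p n = 1 - (bondPercolation (zdGraph d) p).real (annulusCrossing d n) :=
  probReal_compl_eq_one_sub (measurableSet_annulusCrossing d n)

/-- `0 ≤ u_n`. -/
theorem blockProb_nonneg (d : ℕ) (p : unitInterval) (n : ℕ) : 0 ≤ blockProb d p n :=
  measureReal_nonneg

/-- `u_n ≤ 1`. -/
theorem blockProb_le_one (d : ℕ) (p : unitInterval) (n : ℕ) : blockProb d p n ≤ 1 :=
  measureReal_le_one

/-! ## §2 Load-bearing: criticality from above (`p > p_c` kills the statement, every `d ≥ 3`) -/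

/-- An infinite open (lattice) cluster at a point of `Λ_n` crosses the annulus inside `Λ_{2n}`. -/
theorem mem_annulusCrossing_of_percolatesAt {d n : ℕ} {ω : BondConfig (Site d)}
    (hω : ω ⊆ (zdGraph d).edgeSet) {x : Site d} (hx : x ∈ box d n) (h : ω ∈ percolatesAt x) :
    ω ∈ annulusCrossing d n :=
  ⟨x, hx, toBdry_of_percolatesAt (box_subset_box_two_mul d n hx) hω h⟩

/-- On lattice configurations, blocking forces `Λ_n ↮ ∞` (GKZ's `noPercolation`). -/
theorem mem_noPercolation_of_not_mem_annulusCrossing {d n : ℕ} {ω : BondConfig (Site d)}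
    (hω : ω ⊆ (zdGraph d).edgeSet) (h : ω ∈ (annulusCrossing d n)ᶜ) :
    ω ∈ GKZ.noPercolation (GM.ball (0 : Site d) n) := by
  intro z hz hperc
  refine h (mem_annulusCrossing_of_percolatesAt hω ?_ hperc)
  rw [GM.mem_ball] at hz
  rw [mem_box]
  intro i
  simpa using hz i

/-- **Supercritical annuli are crossed up to an exponentially small error**: for `d ≥ 3` and
`p > p_c(ℤ^d)` there is `γ > 0` with `u_n(d,p) ≤ e^{-γ n}` for all `n`
(GKZ 1993 Lemma 5, `GKZ.exists_real_noPercolation_ball_le_exp`, in tree). -/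
theorem blockProb_le_exp_of_criticalProb_lt {d : ℕ} (hd : 3 ≤ d) (p : unitInterval)
    (hp : criticalProb (zdGraph d) (0 : Site d) < p) :
    ∃ γ : ℝ, 0 < γ ∧ ∀ n : ℕ, blockProb d p n ≤ Real.exp (-(γ * n)) := by
  obtain ⟨γ, hγ, h⟩ := GKZ.exists_real_noPercolation_ball_le_exp hd p hp
  refine ⟨γ, hγ, fun n => le_trans ?_ (h 0 n)⟩
  exact real_mono_of_forall_subset_edgeSet (zdGraph d) p
    fun ω hω hb => mem_noPercolation_of_not_mem_annulusCrossing hω hb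

/-- `e^{γ n} > n` for `n` large (`n > 4/γ²` suffices). -/
theorem exp_neg_mul_lt_inv {γ : ℝ} (hγ : 0 < γ) {n : ℕ} (hn : 4 / γ ^ 2 < n) :
    Real.exp (-(γ * n)) < ((n : ℝ))⁻¹ := by
  have hn0 : (0 : ℝ) < n := lt_trans (by positivity) hn
  have h1 : γ * n / 2 + 1 ≤ Real.exp (γ * n / 2) := Real.add_one_le_exp _
  have h2 : Real.exp (γ * n) = Real.exp (γ * n / 2) ^ 2 := by
    rw [← Real.exp_nat_mul]; ring_nf
  have h3 : (n : ℝ) < (γ * n / 2) ^ 2 := by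
    have : 4 < γ ^ 2 * n := by rw [div_lt_iff₀ (by positivity)] at hn; linarith
    nlinarith
  have h4 : (γ * n / 2) ^ 2 ≤ Real.exp (γ * n) := by
    rw [h2]
    exact pow_le_pow_left₀ (by positivity) (le_trans (by linarith) h1) 2
  rw [Real.exp_neg, inv_lt_inv₀ (Real.exp_pos _) hn0]
  linarith

/-- **`p = p_c` is load-bearing from above**: for `d ≥ 3` and every `p > p_c(ℤ^d)` the
`(d, p)`-crux is FALSE (take `s = 1`: `n^{-1} ≤ u_n ≤ e^{-γ n}` fails for large `n`). -/
theorem not_subpolynomialBlockingAt_of_criticalProb_lt {d : ℕ} (hd : 3 ≤ d) (p : unitInterval)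
    (hp : criticalProb (zdGraph d) (0 : Site d) < p) : ¬ SubpolynomialBlockingAt d p := by
  intro h
  obtain ⟨γ, hγ, hb⟩ := blockProb_le_exp_of_criticalProb_lt hd p hp
  have h1 := (subpolynomialBlockingAt_iff d p).1 h 1 one_pos
  rw [eventually_atTop] at h1
  obtain ⟨N, hN⟩ := h1
  set n : ℕ := max N (⌈4 / γ ^ 2⌉₊ + 1) with hn
  have hnN : N ≤ n := le_max_left _ _
  have hn4 : 4 / γ ^ 2 < n := by
    have : (⌈4 / γ ^ 2⌉₊ : ℝ) + 1 ≤ n := by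
      rw [hn]; exact_mod_cast le_max_right _ _
    linarith [Nat.le_ceil (4 / γ ^ 2)]
  have hA := hN n hnN
  rw [Real.rpow_neg_one] at hA
  linarith [hb n, exp_neg_mul_lt_inv hγ hn4]

/-- In particular on `ℤ³`: every `p > p_c(ℤ³)` falsifies the statement. -/
theorem not_subpolynomialBlockingAt_three_of_criticalProb_lt (p : unitInterval)
    (hp : criticalProb (zdGraph 3) (0 : Site 3) < p) : ¬ SubpolynomialBlockingAt 3 p :=
  not_subpolynomialBlockingAt_of_criticalProb_lt le_rfl p hp

/-- **No robustness in `p`**: there is no `δ > 0` such that the statement holds for all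
`p` within `δ` of `p_c(ℤ³)` (refuted strengthening "the property is open at `p_c`"). -/
theorem not_exists_nhds_criticalProb :
    ¬ ∃ δ : ℝ, 0 < δ ∧ ∀ p : unitInterval,
      |(p : ℝ) - criticalProb (zdGraph 3) (0 : Site 3)| < δ → SubpolynomialBlockingAt 3 p := by
  rintro ⟨δ, hδ, h⟩
  set pc : ℝ := criticalProb (zdGraph 3) (0 : Site 3) with hpc
  have hpc1 : pc < 1 := criticalProb_zd_lt_one (by norm_num)
  have hpc0 : 0 ≤ pc := (criticalProb_mem_Icc (zdGraph 3) (0 : Site 3)).1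
  set q : ℝ := min (pc + δ / 2) 1 with hq
  have hq01 : q ∈ unitInterval := ⟨le_min (by linarith) zero_le_one, min_le_right _ _⟩
  have hqgt : pc < q := lt_min (by linarith) hpc1
  have hqδ : |q - pc| < δ := by
    rw [abs_of_pos (by linarith)]
    have : q ≤ pc + δ / 2 := min_le_left _ _
    linarith
  exact not_subpolynomialBlockingAt_three_of_criticalProb_lt ⟨q, hq01⟩ hqgt (h ⟨q, hq01⟩ hqδ)

/-! ## §3 Not load-bearing from below: for `p < p_c` the statement is TRUE (every `d ≥ 2`) -/

/-- Geometry: a vertex of `∂ⁱⁿΛ_{2n}`, seen from a point `x ∈ Λ_n`, is outside the open box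
`x + Λ_n` or on its boundary. -/
theorem sub_notMem_or_mem_innerBoundary {d n : ℕ} {x w : Site d} (hx : x ∈ box d n)
    (hw : w ∈ innerBoundary (zdGraph d) (box d (2 * n))) :
    w - x ∉ box d n ∨ w - x ∈ innerBoundary (zdGraph d) (box d n) := by
  by_cases hwx : w - x ∈ box d n
  · right
    obtain ⟨i, hi⟩ := exists_eq_of_mem_innerBoundary_box hw
    refine mem_innerBoundary_box_of_natAbs_eq hwx (i := i) ?_
    have h1 := (mem_box.1 hx) i
    have h2 := (mem_box.1 hwx) i
    simp only [Pi.sub_apply] at h2 ⊢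
    push_cast at hi h1 h2
    omega
  · exact Or.inl hwx

/-- On lattice configurations an annulus crossing from `x ∈ Λ_n` contains an arm
`x ↔ x + ∂Λ_n` (first exit from `x + Λ_n`). -/
theorem exists_armEvent_of_mem_annulusCrossing {d n : ℕ} {ω : BondConfig (Site d)}
    (hω : ω ⊆ (zdGraph d).edgeSet) (h : ω ∈ annulusCrossing d n) :
    ∃ x ∈ box d n, ω ∈ armEvent x n := by
  obtain ⟨x, hx, w, hw, hxw⟩ := h
  exact ⟨x, hx, armEvent_of_pathIn hω (mem_openConnIn_iff_pathIn.1 hxw)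
    (sub_notMem_or_mem_innerBoundary hx hw)⟩

/-- **Union bound**: `P_p(cross_n) ≤ |Λ_n| · P_p(0 ↔ ∂Λ_n)` for every `d`, `p`, `n`. -/
theorem real_annulusCrossing_le_card_mul (d : ℕ) (p : unitInterval) (n : ℕ) :
    (bondPercolation (zdGraph d) p).real (annulusCrossing d n) ≤
      (box d n).card * (bondPercolation (zdGraph d) p).real (siteToBoundary d n) := by
  calc (bondPercolation (zdGraph d) p).real (annulusCrossing d n)
      ≤ (bondPercolation (zdGraph d) p).real (⋃ x ∈ box d n, armEvent x n) :=
        real_mono_of_forall_subset_edgeSet (zdGraph d) p fun ω hω h => by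
          obtain ⟨x, hx, hxa⟩ := exists_armEvent_of_mem_annulusCrossing hω h
          exact Set.mem_biUnion (Finset.mem_coe.2 hx) hxa
    _ ≤ ∑ x ∈ box d n, (bondPercolation (zdGraph d) p).real (armEvent x n) :=
        measureReal_biUnion_finset_le _ _
    _ = (box d n).card * (bondPercolation (zdGraph d) p).real (siteToBoundary d n) := by
        simp_rw [real_armEvent]
        rw [Finset.sum_const, nsmul_eq_mul]

/-- **Subcritical annuli are blocked up to an exponentially small error**: for `d ≥ 2` and
`p < p_c(ℤ^d)` there is `c > 0` with `P_p(cross_n) ≤ (2n+1)^d e^{-cn}` (sharpness, in tree). -/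
theorem real_annulusCrossing_le_of_lt_criticalProb {d : ℕ} (hd : 2 ≤ d) (p : unitInterval)
    (hp : (p : ℝ) < criticalProb (zdGraph d) (0 : Site d)) :
    ∃ c : ℝ, 0 < c ∧ ∀ n : ℕ, (bondPercolation (zdGraph d) p).real (annulusCrossing d n) ≤
      (2 * n + 1 : ℝ) ^ d * Real.exp (-c * n) := by
  obtain ⟨c, hc, h⟩ := perc_sharpness_holds hd p hp
  refine ⟨c, hc, fun n => le_trans (real_annulusCrossing_le_card_mul d p n) ?_⟩
  rw [card_box]
  push_cast
  exact mul_le_mul_of_nonneg_left (h n) (by positivity)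

/-- `(2n+1)^d e^{-cn} → 0`. -/
theorem tendsto_pow_mul_exp_neg {c : ℝ} (hc : 0 < c) (d : ℕ) :
    Tendsto (fun n : ℕ => (2 * n + 1 : ℝ) ^ d * Real.exp (-c * n)) atTop (𝓝 0) := by
  -- `(c n)^d e^{-c n} → 0`, and `(2n+1)^d ≤ (3/c)^d (cn)^d` for `n ≥ 1`
  have h1 : Tendsto (fun n : ℕ => (c * n) ^ d * Real.exp (-(c * n))) atTop (𝓝 0) :=
    (Real.tendsto_pow_mul_exp_neg_atTop_nhds_zero d).comp
      (tendsto_natCast_atTop_atTop.const_mul_atTop hc)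
  have h2 : Tendsto (fun n : ℕ => (3 / c) ^ d * ((c * n) ^ d * Real.exp (-(c * n)))) atTop (𝓝 0) := by
    simpa using h1.const_mul ((3 / c) ^ d)
  refine tendsto_of_tendsto_of_tendsto_of_le_of_le' tendsto_const_nhds h2
    (Eventually.of_forall fun n => by positivity) ?_
  filter_upwards [eventually_ge_atTop 1] with n hn
  have hn1 : (1 : ℝ) ≤ n := by exact_mod_cast hn
  have hle : (2 * n + 1 : ℝ) ≤ 3 / c * (c * n) := by
    rw [div_mul_eq_mul_div, mul_comm c, ← mul_assoc, mul_div_assoc, div_self hc.ne', mul_one]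
    linarith
  have hpow : (2 * n + 1 : ℝ) ^ d ≤ (3 / c) ^ d * (c * n) ^ d := by
    rw [← mul_pow]; exact pow_le_pow_left₀ (by positivity) hle d
  calc (2 * n + 1 : ℝ) ^ d * Real.exp (-c * n)
      ≤ (3 / c) ^ d * (c * n) ^ d * Real.exp (-c * n) :=
        mul_le_mul_of_nonneg_right hpow (Real.exp_pos _).le
    _ = (3 / c) ^ d * ((c * n) ^ d * Real.exp (-(c * n))) := by rw [neg_mul, mul_assoc]

/-- **Below `p_c` the statement is TRUE** (so `p = p_c` is not load-bearing from below): for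
`d ≥ 2`, `p < p_c(ℤ^d)`, `u_n → 1`, in particular `u_n ≥ n^{-s}` eventually for every `s > 0`. -/
theorem subpolynomialBlockingAt_of_lt_criticalProb {d : ℕ} (hd : 2 ≤ d) (p : unitInterval)
    (hp : (p : ℝ) < criticalProb (zdGraph d) (0 : Site d)) : SubpolynomialBlockingAt d p := by
  rw [subpolynomialBlockingAt_iff]
  intro s hs
  obtain ⟨c, hc, h⟩ := real_annulusCrossing_le_of_lt_criticalProb hd p hp
  have hA : ∀ᶠ n : ℕ in atTop, (2 * n + 1 : ℝ) ^ d * Real.exp (-c * n) < 1 / 2 :=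
    (tendsto_pow_mul_exp_neg hc d).eventually (gt_mem_nhds (by norm_num))
  have hB : ∀ᶠ n : ℕ in atTop, (n : ℝ) ^ (-s) < 1 / 2 :=
    ((tendsto_rpow_neg_atTop hs).comp tendsto_natCast_atTop_atTop).eventually (gt_mem_nhds (by norm_num))
  filter_upwards [hA, hB] with n hA hB
  rw [blockProb_eq]
  linarith [h n]

/-- The three regimes on `ℤ³` in one statement: TRUE below `p_c`, FALSE above `p_c`
(the crux is the remaining boundary case `p = p_c`). -/
theorem subpolynomialBlockingAt_three_iff_of_ne (p : unitInterval)
    (hp : (p : ℝ) ≠ criticalProb (zdGraph 3) (0 : Site 3)) :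
    SubpolynomialBlockingAt 3 p ↔ (p : ℝ) < criticalProb (zdGraph 3) (0 : Site 3) := by
  rcases lt_or_gt_of_ne hp with h | h
  · exact ⟨fun _ => h, fun _ => subpolynomialBlockingAt_of_lt_criticalProb (by norm_num) p h⟩
  · exact ⟨fun hS => absurd hS (not_subpolynomialBlockingAt_three_of_criticalProb_lt p h),
      fun h' => absurd h (not_lt.2 h'.le)⟩

/-! ## §4 Load-bearing: the dimension (`d ≥ 7` with (t-c)/`η = 0` kills the statement with rate `1/n`) -/

/-- **Quantitative Aizenman above six dimensions**: in `d = m + 7`, under the two-point bounds of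
`TwoPointBoundedRatio`, the critical annulus is blocked with probability at most `K/n` for `n ≥ 1`
(`real_numSpanning_ge` with `ε = n^{-(m+1)}`: `N_n ≥ 1` with probability `≥ 1 - 2κ n^{-(d-6)}`, then
bulk spanning `⊆` annulus crossing). -/
theorem blockProb_le_div {m : ℕ} (hτ : TwoPointBoundedRatio (m + 7)) :
    ∃ K : ℝ, 0 ≤ K ∧ ∀ n : ℕ, 1 ≤ n → blockProb (m + 7) (criticalProbI (m + 7)) n ≤ K / n := by
  obtain ⟨C', C, hC', -, hb⟩ := hτ.natPow (by omega)
  have e5 : m + 7 - 2 = m + 5 := by omega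
  have hLow : ∀ x y : Site (m + 7), x ≠ y →
      C' * (‖x - y‖ ^ (m + 5))⁻¹ ≤ tau (m + 7) (criticalProbI (m + 7)) x y :=
    fun x y hxy => by have h := (hb x y hxy).1; rwa [e5] at h
  have hUp : ∀ x y : Site (m + 7), x ≠ y →
      tau (m + 7) (criticalProbI (m + 7)) x y ≤ C * (‖x - y‖ ^ (m + 5))⁻¹ :=
    fun x y hxy => by have h := (hb x y hxy).2; rwa [e5] at h
  have hU := tau_le_rieszWt_of_upper (criticalProbI (m + 7)) hUp
  set κ : ℝ := 4 * spanningDiagConst m (max C 1) / (C' * 2 ^ (m + 7)) ^ 2 with hκ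
  have hκ0 : 0 ≤ κ := by
    have : 0 ≤ spanningDiagConst m (max C 1) :=
      spanningDiagConst_nonneg (le_trans zero_le_one (le_max_right _ _))
    positivity
  refine ⟨2 * κ, by positivity, fun n hn => ?_⟩
  have hn0 : (0 : ℝ) < n := by exact_mod_cast hn
  set ε : ℝ := ((n : ℝ) ^ (m + 1))⁻¹ with hε
  have hε0 : 0 < ε := by positivity
  have key := real_numSpanning_ge (criticalProbI (m + 7)) hC' hLow hU hn hε0
  -- the event `{N_n ≥ ε n^{m+1}} = {N_n ≥ 1}` lies in `bulkSpanning ⊆ annulusCrossing` (in measure)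
  have hεn : ε * (n : ℝ) ^ (m + 1) = 1 := by rw [hε, inv_mul_cancel₀ (by positivity)]
  have hsub : {ω : BondConfig (Site (m + 7)) |
      ENNReal.ofReal (ε * (n : ℝ) ^ (m + 1)) ≤ (numSpanningClusters (m + 7) n ω : ENNReal)} ⊆
        bulkSpanning (m + 7) n := fun ω hω =>
    mem_bulkSpanning_of_ofReal_le (by rw [hεn]; exact one_pos) hω
  have hcross : 1 - κ * (((n : ℝ) ^ (m + 1))⁻¹ + ε) ≤
      (bondPercolation (zdGraph (m + 7)) (criticalProbI (m + 7))).real (annulusCrossing (m + 7) n) :=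
    key.trans ((measureReal_mono hsub).trans (real_bulkSpanning_le_real_annulusCrossing _ _ _))
  rw [blockProb_eq]
  have hε' : ((n : ℝ) ^ (m + 1))⁻¹ + ε = 2 * ε := by rw [hε]; ring
  rw [hε'] at hcross
  -- `ε ≤ 1/n`
  have hεle : ε ≤ (n : ℝ)⁻¹ := by
    rw [hε]
    refine inv_anti₀ hn0 ?_
    calc (n : ℝ) = (n : ℝ) ^ 1 := (pow_one _).symm
      _ ≤ (n : ℝ) ^ (m + 1) := pow_le_pow_right₀ (by exact_mod_cast hn) (by omega)
  calc 1 - (bondPercolation (zdGraph (m + 7)) (criticalProbI (m + 7))).real (annulusCrossing (m + 7) n)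
      ≤ κ * (2 * ε) := by linarith
    _ ≤ κ * (2 * (n : ℝ)⁻¹) := by gcongr
    _ = 2 * κ / n := by ring

/-- The sharper rate from the same second-moment bound: `u_n(d, p_c) ≤ K / n^{d-6}` for `n ≥ 1` in `d = m + 7`
under `TwoPointBoundedRatio` (Aizenman 1997, Thm. 4 (3): `N_n ≳ n^{d-6}` spanning clusters; here only `N_n ≥ 1` is used,
with failure probability `2κ n^{-(d-6)}`). -/
theorem blockProb_le_div_pow {m : ℕ} (hτ : TwoPointBoundedRatio (m + 7)) :
    ∃ K : ℝ, 0 ≤ K ∧ ∀ n : ℕ, 1 ≤ n →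
      blockProb (m + 7) (criticalProbI (m + 7)) n ≤ K / (n : ℝ) ^ (m + 1) := by
  obtain ⟨C', C, hC', -, hb⟩ := hτ.natPow (by omega)
  have e5 : m + 7 - 2 = m + 5 := by omega
  have hLow : ∀ x y : Site (m + 7), x ≠ y →
      C' * (‖x - y‖ ^ (m + 5))⁻¹ ≤ tau (m + 7) (criticalProbI (m + 7)) x y :=
    fun x y hxy => by have h := (hb x y hxy).1; rwa [e5] at h
  have hUp : ∀ x y : Site (m + 7), x ≠ y →
      tau (m + 7) (criticalProbI (m + 7)) x y ≤ C * (‖x - y‖ ^ (m + 5))⁻¹ :=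
    fun x y hxy => by have h := (hb x y hxy).2; rwa [e5] at h
  have hU := tau_le_rieszWt_of_upper (criticalProbI (m + 7)) hUp
  set κ : ℝ := 4 * spanningDiagConst m (max C 1) / (C' * 2 ^ (m + 7)) ^ 2 with hκ
  have hκ0 : 0 ≤ κ := by
    have : 0 ≤ spanningDiagConst m (max C 1) :=
      spanningDiagConst_nonneg (le_trans zero_le_one (le_max_right _ _))
    positivity
  refine ⟨2 * κ, by positivity, fun n hn => ?_⟩
  have hn0 : (0 : ℝ) < n := by exact_mod_cast hn
  set ε : ℝ := ((n : ℝ) ^ (m + 1))⁻¹ with hε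
  have hε0 : 0 < ε := by positivity
  have key := real_numSpanning_ge (criticalProbI (m + 7)) hC' hLow hU hn hε0
  have hεn : ε * (n : ℝ) ^ (m + 1) = 1 := by rw [hε, inv_mul_cancel₀ (by positivity)]
  have hsub : {ω : BondConfig (Site (m + 7)) |
      ENNReal.ofReal (ε * (n : ℝ) ^ (m + 1)) ≤ (numSpanningClusters (m + 7) n ω : ENNReal)} ⊆
        bulkSpanning (m + 7) n := fun ω hω =>
    mem_bulkSpanning_of_ofReal_le (by rw [hεn]; exact one_pos) hω
  have hcross : 1 - κ * (((n : ℝ) ^ (m + 1))⁻¹ + ε) ≤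
      (bondPercolation (zdGraph (m + 7)) (criticalProbI (m + 7))).real (annulusCrossing (m + 7) n) :=
    key.trans ((measureReal_mono hsub).trans (real_bulkSpanning_le_real_annulusCrossing _ _ _))
  rw [blockProb_eq]
  have hε' : ((n : ℝ) ^ (m + 1))⁻¹ + ε = 2 * ε := by rw [hε]; ring
  rw [hε'] at hcross
  calc 1 - (bondPercolation (zdGraph (m + 7)) (criticalProbI (m + 7))).real (annulusCrossing (m + 7) n)
      ≤ κ * (2 * ε) := by linarith
    _ = 2 * κ / (n : ℝ) ^ (m + 1) := by rw [hε]; ring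

/-- **The dimension is load-bearing**: for every `d > 6` satisfying Aizenman's hypothesis
`TwoPointBoundedRatio d` ((t-c) with `η = 0`), the `d`-dimensional crux at `p_c(ℤ^d)` is FALSE
(`s = 1/2`: `n^{-1/2} ≤ u_n ≤ K/n` fails for `n > K²`). Any proof of the crux must therefore use an
input that fails above six dimensions. -/
theorem not_subpolynomialBlockingAt_criticalProb_above_six {d : ℕ} (hd : 6 < d)
    (hτ : TwoPointBoundedRatio d) : ¬ SubpolynomialBlockingAt d (criticalProbI d) := by
  obtain ⟨m, rfl⟩ : ∃ m, d = m + 7 := ⟨d - 7, by omega⟩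
  obtain ⟨K, hK, hb⟩ := blockProb_le_div hτ
  intro h
  have h1 := (subpolynomialBlockingAt_iff _ _).1 h (1 / 2) (by norm_num)
  rw [eventually_atTop] at h1
  obtain ⟨N, hN⟩ := h1
  -- pick `n ≥ N`, `n ≥ 1`, `n > 4 K²`
  set n : ℕ := max N (⌈4 * K ^ 2⌉₊ + 1) with hn
  have hnN : N ≤ n := le_max_left _ _
  have hn1 : 1 ≤ n := le_trans (Nat.succ_le_succ (Nat.zero_le _)) (le_max_right _ _)
  have hn0 : (0 : ℝ) < n := by exact_mod_cast hn1
  have hnK : 4 * K ^ 2 < n := by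
    have : (⌈4 * K ^ 2⌉₊ : ℝ) + 1 ≤ n := by rw [hn]; exact_mod_cast le_max_right _ _
    linarith [Nat.le_ceil (4 * K ^ 2)]
  have hA := (hN n hnN).trans (hb n hn1)
  -- `n^{-1/2} ≤ K / n` means `√n ≤ K`, i.e. `n ≤ K²`
  have hsq : Real.sqrt n ≤ K := by
    have e1 : (n : ℝ) ^ (-(1 / 2 : ℝ)) = (Real.sqrt n)⁻¹ := by
      rw [Real.rpow_neg hn0.le, Real.sqrt_eq_rpow]
    rw [e1] at hA
    have hs0 : 0 < Real.sqrt n := Real.sqrt_pos.2 hn0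
    rw [inv_le_iff_one_le_mul₀ hs0] at hA
    -- `1 ≤ K / n * √n = K / √n`
    have : K / n * Real.sqrt n = K / Real.sqrt n := by
      rw [div_mul_eq_mul_div, div_eq_div_iff hn0.ne' hs0.ne']
      rw [mul_assoc, Real.mul_self_sqrt hn0.le]
    rw [this, le_div_iff₀ hs0, one_mul] at hA
    exact hA
  have hK2 : (n : ℝ) ≤ K ^ 2 := by
    have := pow_le_pow_left₀ (Real.sqrt_nonneg _) hsq 2
    rwa [Real.sq_sqrt hn0.le] at this
  nlinarith

/-- **Unconditionally in the dimension, modulo the named fact `Hara2008_etaZeroXSpace`**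
(Heydenreich–van der Hofstad 2017, Thm. 11.4): for `d ≥ 11` the `d`-dimensional crux is false. -/
theorem not_subpolynomialBlockingAt_criticalProb_of_hara (h : Hara2008_etaZeroXSpace) {d : ℕ}
    (hd : 11 ≤ d) : ¬ SubpolynomialBlockingAt d (criticalProbI d) :=
  not_subpolynomialBlockingAt_criticalProb_above_six (by omega) (h.twoPointBoundedRatio hd)

/-! ## §5 The jump world: `θ(p) > 0` forces `u_n → 0` (the crux is then a pure rate statement) -/

/-- `{some vertex of S percolates}` is measurable. -/
theorem measurableSet_exists_percolatesAt {d : ℕ} (S : Finset (Site d)) :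
    MeasurableSet {ω : BondConfig (Site d) | ∃ y ∈ S, ω ∈ percolatesAt y} := by
  have : {ω : BondConfig (Site d) | ∃ y ∈ S, ω ∈ percolatesAt y} = ⋃ y ∈ S, percolatesAt y := by
    ext ω; simp only [Set.mem_setOf_eq, Set.mem_iUnion, exists_prop]
  rw [this]
  exact Finset.measurableSet_biUnion _ fun y _ => measurableSet_percolatesAt_holds y

/-- Blocking forces "no vertex of `Λ_n` percolates" (a.s.): `u_n ≤ 1 - P(Λ_n ↔ ∞)`. -/
theorem blockProb_le_one_sub_real_exists_percolatesAt (d : ℕ) (p : unitInterval) (n : ℕ) :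
    blockProb d p n ≤
      1 - (bondPercolation (zdGraph d) p).real {ω | ∃ y ∈ box d n, ω ∈ percolatesAt y} := by
  rw [← probReal_compl_eq_one_sub (measurableSet_exists_percolatesAt (box d n))]
  exact real_mono_of_forall_subset_edgeSet (zdGraph d) p fun ω hω hb =>
    fun ⟨y, hy, hperc⟩ => hb (mem_annulusCrossing_of_percolatesAt hω hy hperc)

/-- **In the jump world the blocking probability tends to zero**: if `θ(p) > 0` on `ℤ^d`
(`d ≥ 1`) then `u_n(d,p) → 0` (uniform percolation from large sets,
`exists_card_le_imp_lt_real_exists_percolatesAt`, in tree). At `p = p_c(ℤ³)` with `θ(p_c) > 0`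
the crux therefore asserts only that this convergence is slower than every power — consistent,
so the jump world does not refute the crux by itself. -/
theorem tendsto_blockProb_zero_of_theta_pos {d : ℕ} (hd : 1 ≤ d) (p : unitInterval)
    (hθ : 0 < theta (zdGraph d) (0 : Site d) p) :
    Tendsto (fun n : ℕ => blockProb d p n) atTop (𝓝 0) := by
  rw [Metric.tendsto_atTop]
  intro ε hε
  obtain ⟨m₀, hm₀⟩ := exists_card_le_imp_lt_real_exists_percolatesAt p hθ hε
  refine ⟨m₀, fun n hn => ?_⟩
  rw [Real.dist_eq, sub_zero, abs_of_nonneg (blockProb_nonneg d p n)]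
  have hcard : m₀ ≤ (box d n).card := by
    rw [card_box]
    calc m₀ ≤ n := hn
      _ ≤ 2 * n + 1 := by omega
      _ = (2 * n + 1) ^ 1 := (pow_one _).symm
      _ ≤ (2 * n + 1) ^ d := Nat.pow_le_pow_right (by omega) hd
  have h := hm₀ (box d n) hcard
  linarith [blockProb_le_one_sub_real_exists_percolatesAt d p n]

/-- Calibration (known; the assembly of route `PercAnnulusCrossing` in five lines): the STRONG form of
the crux, `CritAnnulusNonCrossing` (`u_n ≥ c`), already yields `θ(p_c) = 0`, because `θ(p_c) > 0`
would force `u_n → 0` (§5). The sub-polynomial form does NOT close the conjunct this way. -/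
theorem percolationContinuityZ3_of_critAnnulusNonCrossing
    (h : PercAnnulusCrossing.CritAnnulusNonCrossing) : _root_.PercolationContinuityZ3 := by
  rw [_root_.PercolationContinuityZ3, percolationContinuityZ3_iff]
  by_contra hne
  have hθ : 0 < theta (zdGraph 3) (0 : Site 3) (criticalProbI 3) :=
    lt_of_le_of_ne measureReal_nonneg (Ne.symm hne)
  obtain ⟨c, hc, hb⟩ := h
  have ht := tendsto_blockProb_zero_of_theta_pos (by norm_num) (criticalProbI 3) hθ
  have hev : ∀ᶠ n : ℕ in atTop, c ≤ blockProb 3 (criticalProbI 3) n := by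
    filter_upwards [eventually_ge_atTop 1] with n hn
    rw [blockProb_eq]
    have hb' : (bondPercolation (zdGraph 3) (criticalProbI 3)).real (annulusCrossing 3 n) ≤ 1 - c :=
      hb n hn
    linarith
  have := ge_of_tendsto ht hev
  linarith

/-- Calibration: the crux is implied by `PercAnnulusCrossing.CritAnnulusNonCrossing`
(`u_n ≥ c ≥ n^{-s}` eventually). -/
theorem of_critAnnulusNonCrossing (h : PercAnnulusCrossing.CritAnnulusNonCrossing) :
    PercNonProliferation.SubpolynomialBlocking := by
  rw [crux_iff, subpolynomialBlockingAt_iff]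
  intro s hs
  obtain ⟨c, hc, hb⟩ := h
  have hB : ∀ᶠ n : ℕ in atTop, (n : ℝ) ^ (-s) < c :=
    ((tendsto_rpow_neg_atTop hs).comp tendsto_natCast_atTop_atTop).eventually (gt_mem_nhds hc)
  filter_upwards [hB, eventually_ge_atTop 1] with n hB hn
  rw [blockProb_eq]
  have hb' : (bondPercolation (zdGraph 3) (criticalProbI 3)).real (annulusCrossing 3 n) ≤ 1 - c :=
    hb n hn
  linarith

/-! ## §6 Refuted natural strengthenings at `p_c(ℤ³)` -/

/-- A critical one-arm from the origin to `∂Λ_{2n}` crosses the annulus. -/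
theorem real_siteToBoundary_le_real_annulusCrossing (d : ℕ) (p : unitInterval) (n : ℕ) :
    (bondPercolation (zdGraph d) p).real (siteToBoundary d (2 * n)) ≤
      (bondPercolation (zdGraph d) p).real (annulusCrossing d n) :=
  measureReal_mono fun ω h => ⟨0, zero_mem_box d n, h⟩

/-- `u_n < 1` for every `n`, every `d ≥ 1` and every `p > 0`
(`u_n ≤ 1 - P_p(0 ↔ ∂Λ_{2n}) ≤ 1 - p^{2n}`). -/
theorem blockProb_lt_one {d : ℕ} (hd : 1 ≤ d) (p : unitInterval) (hp : 0 < (p : ℝ)) (n : ℕ) :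
    blockProb d p n < 1 := by
  rw [blockProb_eq]
  have := DKT20.real_siteToBoundary_pos hd p hp (2 * n)
  linarith [real_siteToBoundary_le_real_annulusCrossing d p n]

/-- In particular at `p_c(ℤ³) > 0`. -/
theorem blockProb_criticalProb_three_lt_one (n : ℕ) : blockProb 3 (criticalProbI 3) n < 1 :=
  blockProb_lt_one (by norm_num) _ (criticalProb_zd_pos 3 (by norm_num)) n

/-- **Refuted strengthening 1 (quantifier order)**: the eventuality cannot be uniform in `s`
(`∃ N ∀ s ∀ n ≥ N` is FALSE): `sup_{s>0} n^{-s} = 1 > u_n`. -/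
theorem not_uniform_in_s :
    ¬ ∃ N : ℕ, ∀ s : ℝ, 0 < s → ∀ n : ℕ, N ≤ n →
      (n : ℝ) ^ (-s) ≤ blockProb 3 (criticalProbI 3) n := by
  rintro ⟨N, hN⟩
  set n : ℕ := N + 1 with hn
  set b : ℝ := blockProb 3 (criticalProbI 3) n with hbdef
  have hb : b < 1 := blockProb_criticalProb_three_lt_one n
  have h1b : 0 < 1 - b := by linarith
  have hn0 : (0 : ℝ) < n := by rw [hn]; positivity
  have hn1 : (1 : ℝ) ≤ n := by rw [hn]; exact_mod_cast Nat.succ_le_succ (Nat.zero_le N)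
  have hlog : 0 ≤ Real.log n := Real.log_nonneg hn1
  set s : ℝ := (1 - b) / (2 * (Real.log n + 1)) with hs
  have hs0 : 0 < s := div_pos h1b (by positivity)
  have key := hN s hs0 n (Nat.le_succ N)
  have h1 : 1 - s * Real.log n ≤ (n : ℝ) ^ (-s) := by
    rw [Real.rpow_def_of_pos hn0]
    have := Real.add_one_le_exp (Real.log n * (-s))
    linarith
  have h2 : s * Real.log n < 1 - b := by
    have e : s * (Real.log n + 1) = (1 - b) / 2 := by
      rw [hs]; field_simp
    nlinarith
  have : (n : ℝ) ^ (-s) ≤ b := key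
  linarith

/-- **Refuted strengthening 2 (the endpoint `s = 0`)**: `u_n ≥ n^{0} = 1` eventually is FALSE. -/
theorem not_exponent_zero :
    ¬ ∀ᶠ n : ℕ in atTop, (n : ℝ) ^ (-(0 : ℝ)) ≤ blockProb 3 (criticalProbI 3) n := by
  intro h
  rw [eventually_atTop] at h
  obtain ⟨N, hN⟩ := h
  have := hN N le_rfl
  rw [neg_zero, Real.rpow_zero] at this
  linarith [blockProb_criticalProb_three_lt_one N]

/-- **Refuted strengthening 3 (no eventuality)**: `∀ s > 0, ∀ n ≥ 1, n^{-s} ≤ u_n` is FALSE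
(at `n = 1`, `1^{-s} = 1 > u_1`). -/
theorem not_forall_n :
    ¬ ∀ s : ℝ, 0 < s → ∀ n : ℕ, 1 ≤ n → (n : ℝ) ^ (-s) ≤ blockProb 3 (criticalProbI 3) n := by
  intro h
  have := h 1 one_pos 1 le_rfl
  rw [Nat.cast_one, Real.one_rpow] at this
  linarith [blockProb_criticalProb_three_lt_one 1]

/-! ## §7 What IS known unconditionally: only the surface-order floor `(1-p)^{|∂_E Λ_n|} ≤ u_n` -/

/-- If every edge of the edge boundary of `Λ_n` is closed (`n ≥ 1`, lattice configuration), the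
annulus is blocked: an open path from `Λ_n` to `∂ⁱⁿΛ_{2n} ∌ Λ_n` must leave `Λ_n` through `∂_E Λ_n`. -/
theorem not_mem_annulusCrossing_of_forall_notMem {d n : ℕ} (hn : 1 ≤ n) {ω : BondConfig (Site d)}
    (hω : ω ⊆ (zdGraph d).edgeSet) (h : ∀ e ∈ edgeBoundary (zdGraph d) (box d n), e ∉ ω) :
    ω ∈ (annulusCrossing d n)ᶜ := by
  rintro ⟨x, hx, w, hw, hxw⟩
  have hpath := mem_openConnIn_iff_pathIn.1 hxw
  have hwn : w ∉ box d n := notMem_box_of_mem_innerBoundary_box (by omega) hw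
  obtain ⟨a, b, ha, hb, -, hab, -⟩ := hpath.exit (R := (↑(box d n) : Set (Site d)))
    (Finset.mem_coe.2 hx) (fun h' => hwn (Finset.mem_coe.1 h'))
  have he : s(a, b) ∈ ω := ((openGraph_adj ω a b).1 hab).1
  refine h _ ?_ he
  rw [mem_edgeBoundary_iff]
  exact ⟨hω he, ⟨a, Finset.mem_coe.1 ha, Sym2.mem_mk_left _ _⟩,
    ⟨b, fun hb' => hb (Finset.mem_coe.2 hb'), Sym2.mem_mk_right _ _⟩⟩

/-- **The trivial floor** (all that is known in `d = 3` at `p_c`): for `n ≥ 1`,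
`(1 - p)^{|∂_E Λ_n|} ≤ u_n(d, p)`, with `|∂_E Λ_n| = O(n^{d-1})`
(`Literature.Probability.LatticeModels.tendsto_card_edgeBoundary_box_div`), i.e. `u_n ≥ e^{-C n²}` on `ℤ³` — to be
compared with the crux's `n^{-s}`. Nothing between `e^{-Cn²}` and `n^{-s}` is in print. -/
theorem pow_card_edgeBoundary_le_blockProb {d n : ℕ} (hn : 1 ≤ n) (p : unitInterval) :
    (1 - (p : ℝ)) ^ (edgeBoundary (zdGraph d) (box d n)).card ≤ blockProb d p n :=
  (le_bondPercolation_real_forall_notMem (zdGraph d) p _).trans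
    (real_mono_of_forall_subset_edgeSet (zdGraph d) p fun _ hω h =>
      not_mem_annulusCrossing_of_forall_notMem hn hω h)

/-- The floor is positive at `p_c(ℤ³) < 1`: `0 < u_n` for `n ≥ 1` (and `u_n < 1`, §6). -/
theorem blockProb_criticalProb_three_pos {n : ℕ} (hn : 1 ≤ n) : 0 < blockProb 3 (criticalProbI 3) n := by
  refine lt_of_lt_of_le (pow_pos ?_ _) (pow_card_edgeBoundary_le_blockProb hn (criticalProbI 3))
  have : ((criticalProbI 3 : unitInterval) : ℝ) < 1 := criticalProb_zd_lt_one (by norm_num)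
  linarith

/-- **The floor is ATTAINED at `n = 1`** (tightness of §7): `u_1(d,p) = (1-p)^{|∂_E Λ_1|}` exactly — the annulus
`Λ_2 ∖ Λ_1` is blocked iff every lattice edge leaving `Λ_1` (each lands on `∂ⁱⁿΛ_2`) is closed. On `ℤ³` at `p_c`:
`u_1 = (1 - p_c)^{54} ≈ 1.9·10⁻⁷` — the size of the constants hidden in the crux. -/
theorem blockProb_one_eq (d : ℕ) (p : unitInterval) :
    blockProb d p 1 = (1 - (p : ℝ)) ^ (edgeBoundary (zdGraph d) (box d 1)).card := by
  have hF : (↑(edgeBoundary (zdGraph d) (box d 1)) : Set (Sym2 (Site d))) ⊆ (zdGraph d).edgeSet :=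
    fun e he => (mem_edgeBoundary_iff.1 (Finset.mem_coe.1 he)).1
  refine le_antisymm ?_ (pow_card_edgeBoundary_le_blockProb le_rfl p)
  rw [← BGN.bondPercolation_real_forall_notMem_eq (zdGraph d) p _ hF]
  refine real_mono_of_forall_subset_edgeSet (zdGraph d) p fun ω hω hb => ?_
  intro e he heω
  obtain ⟨hE, ⟨x, hx, hxe⟩, ⟨y, hy, hye⟩⟩ := mem_edgeBoundary_iff.1 he
  have hxy : x ≠ y := fun h => hy (h ▸ hx)
  have hexy : e = s(x, y) := (Sym2.mem_and_mem_iff hxy).1 ⟨hxe, hye⟩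
  subst hexy
  have hadj : (zdGraph d).Adj x y := hE
  have hy2 : y ∈ box d 2 := DCT16.mem_box_succ_of_adj hx hadj
  -- `y ∉ Λ_1`, `y ∈ Λ_2`, neighbour of a site of `Λ_1`: some coordinate of `y` has absolute value `2`
  have hyb : y ∈ innerBoundary (zdGraph d) (box d (2 * 1)) := by
    rw [mem_box, not_forall] at hy
    obtain ⟨i, hi⟩ := hy
    have h1 := (mem_box.1 hx) i
    have h2 := (mem_box.1 hy2) i
    have h3 := DCT16.abs_sub_le_one_of_adj hadj i
    refine mem_innerBoundary_box_of_natAbs_eq hy2 (i := i) ?_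
    rw [abs_le] at h3
    push_cast at h1 h2 hi ⊢
    omega
  refine hb ⟨x, hx, y, hyb, mem_openConnIn_of_pathIn (PathIn.of_adj ?_ ?_ ?_)⟩
  · exact Finset.mem_coe.2 (box_mono d (by norm_num) hx)
  · exact Finset.mem_coe.2 hy2
  · exact (openGraph_adj ω x y).2 ⟨heω, hxy⟩

/-! ## §7b Aspect ratio: the crux (ratio 2) is the STRONGEST of the ratio-`2^k` family -/

/-- The ratio-`R` blocking probability `u_n^{(R)} = P_p(Λ_n ↮ ∂ⁱⁿΛ_{Rn} in Λ_{Rn})` (the crux uses `R = 2`). -/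
def blockProbR (d : ℕ) (p : unitInterval) (R n : ℕ) : ℝ :=
  (bondPercolation (zdGraph d) p).real {ω | ¬ ∃ x ∈ box d n,
    ∃ y ∈ innerBoundary (zdGraph d) (box d (R * n)),
      ω ∈ openConnIn (↑(box d (R * n)) : Set (Site d)) x y}

/-- `blockProbR … 2 n` is the crux's `u_n` (definitional). -/
theorem blockProbR_two (d : ℕ) (p : unitInterval) (n : ℕ) : blockProbR d p 2 n = blockProb d p n := rfl

/-- **Ratio monotonicity**: `u^{(2)}_{2n} ≤ u^{(4)}_n` — a crossing from `Λ_n ⊆ Λ_{2n}` to `∂ⁱⁿΛ_{4n}` inside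
`Λ_{4n}` is in particular a crossing from `Λ_{2n}`. Hence sub-polynomial blocking at ratio 2 (the crux, along even
`n`) implies it at ratio 4: the planner filed the strongest member of the family. REPAIR CANDIDATE recorded for the
record (not a refutation): should ratio-2 numerics (jobs j008779/j008788) show polynomial decay while larger ratios
plateau, the natural weakening is the ratio-`R` statement for some fixed `R ≥ 4`, which still caps `E N_n` by BK at
that ratio. -/
theorem blockProbR_two_le_four (d : ℕ) (p : unitInterval) (n : ℕ) :
    blockProbR d p 2 (2 * n) ≤ blockProbR d p 4 n := by
  refine measureReal_mono fun ω hω hcross => hω ?_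
  obtain ⟨x, hx, y, hy, hxy⟩ := hcross
  have e : 4 * n = 2 * (2 * n) := by ring
  refine ⟨x, box_mono d (by omega) hx, y, ?_, ?_⟩
  · rw [← e]; exact hy
  · rw [← e]; exact hxy

/-! ## §8 Targets (the lead's stuck stubs)

None yet: `payload.stuck_stubs = []`, no line picked (`Lines/` empty). On re-arm, kills of stub
signatures go here as `theorem <stub>_false : ¬ <stub> := …`.

## §9 Near-misses / open ends (documentation only, no `sorry` kept)

* LANDED as importable negative knowledge (`--supports` 4446):
  `Summits/…/Theorems/SubpolynomialBlocking/Negative/OffCritical.lean` (p72819, accepted: §1–§3),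
  `…/Negative/AboveSix.lean` (p73467, accepted: §4), `…/Negative/Strengthenings.lean` (p73922, accepted: §5–§7),
  `…/Negative/FloorAttained.lean` (p83322: `blockProb_one_eq`);
  namespace `Summit.CriticalPhenomena.PercolationContinuityZ3.Theorems.SubpolynomialBlocking.Negative`.
* NUMERICS (cheapest falsifier), Monte Carlo at `p = 0.2488118` (script `mcjob/main.py`, block-diagonal union of samples +
  `scipy` connected components): PILOT j013791 (2026-08-16): ratio 2 — `n = 1`: 0 blocked / 20000 (`u_1 < 1.9·10⁻⁴`, 95 %),
  `n = 2`: 0/8000, `n = 3`: 0/3000; ratio 3 — `n = 1`: 1/4000 (`≈ 2.5·10⁻⁴`), `n = 2`: 0/2000. The ratio-2 constant is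
  ASTRONOMICALLY small: exactly `u_1 = (1 - p_c)^{54} ≈ 1.9·10⁻⁷` (blocked iff the 54 lattice edges leaving `Λ_1`, all of
  which land on `∂ⁱⁿΛ_2`, are closed — the §7 floor is attained at `n = 1`), and in-house data on item 0846 give blocking `≈ 0.01 / 0.06 / 0.12 / 0.19 / 0.26` at ratios `4 / 6 / 8 / 12 / 16`
  (scale-invariant in `n`). So ratio-2 MC can only bound `u_n` from above (`~10⁻⁶` level); the informative test of the
  underlying hyperscaling hypothesis is scale invariance (plateau in `n`) of the ratio-3/4 blocking probabilities.
  MEDIUM RUN j013813 (2026-08-16, 225 s, evidence on 4446): ratio 2 — 0 blocked in 5·10⁵ / 5·10⁵ / 4·10⁵ / 2.5·10⁵ /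
  1.2·10⁵ / 6·10⁴ samples for `n = 1 … 6` (`u_n ≲ 10⁻⁵`, 95 % upper bounds `7.7·10⁻⁶ … 6.4·10⁻⁵`); ratio 3 — `u_1 = 3.4·10⁻⁴`
  (34/10⁵), `u_2 = 1.0·10⁻⁴` (10/10⁵), `u_3 < 7.7·10⁻⁵` (0/5·10⁴): at ratio 3 the blocking probability FALLS by a factor
  `≈ 3.4` from `n = 1` to `n = 2` (local exponent `-1.77`) — small-`n` lattice transient or genuine decay is exactly what the
  larger runs must decide. QUEUED: j013825 (ratio 2 `n ≤ 10`, ratio 3 `n ≤ 6`, up to 4·10⁶ samples), j014008 (ratio 3 and 4,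
  `n = 1…8`, ~100–250 blocked events per row at ratio 4) — evidence auto-attached to 4446; a steady DECAY in `n` at fixed ratio 3/4 would be
  a numerical kill signal for the hyperscaling picture (hence for the crux), a plateau supports it. CONSEQUENCE FOR THE ROUTE:
  even if true, the crux's implicit constants are `≲ 10⁻⁶` (BK cap `E N_n ≤ 1/u_n ≳ 10⁶` before asymptotics) — harmless for the
  `n^{-s}` asymptotics of `PolynomialAssembly`, fatal for any finite-size use.
* By-product: `PercAnnulusCrossing.CrossingTendstoOne` (item 0848) and that route's `Assembly` (0847) are PROVED by the
  argument of §5 (candidate file attached as evidence on 0848; refuters do not land positives).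

* The crux itself and its negation are both open: §2–§4 show that any proof must use BOTH
  `p ≤ p_c` and a `d ≤ 6` input, and any disproof must produce the `d > 6` rate `u_n ≤ K/n^{a}` in
  `d = 3`, for which no mechanism exists (`TwoPointBoundedRatio 3` is itself refuted by the
  one-arm bound, `TwoPointBoundedRatio.six_le`).
* Not attempted in Lean (no tree support): slab RSW (Newman–Tassion–Wu 2017) gives `u_n(slab_k) ≥ c_k`
  with `c_k → 0`; it does not transfer to `ℤ³`.
-/

end Summit.CriticalPhenomena.PercolationContinuityZ3.Cruxes.SubpolynomialBlocking.Disproof
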